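import Literature.MathematicalPhysics.QuantumFieldTheory.Balaban1983to89.Node00.Record13SepCoPHV
import Summits.QuantumFields.YangMills.Theses.BalabanUVNodes

/-! # CRIT-2 g3 — bounded by-name cross-check of DEF-1's version slot p620607 (`Record13SepCoPHV.lean`):
the β-side and the B12-side of the record datum are REVISION-INVARIANT by `rfl`, so every β-letter road
(idea-5 ★⁸, idea-7 T13, U3ᴷ, 2ᶜᴰ) re-keys to a K1⁹-type (B)-over-the-slot witness in one line. Scratch only. -/

open Literature.MathematicalPhysics.QuantumFieldTheory.Balaban1983to89
open Literature.MathematicalPhysics.QuantumFieldTheory.Balaban1983to89.T4Continuum (T4Family)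
open Literature.MathematicalPhysics.QuantumFieldTheory.Balaban1983to89.DagBinding (EndpointExistence)

namespace Crit2VersionSlotProbe

variable (F : T4Family) (θ : Node00.Stage13HParams F 2) (h : θ.Provisos₁₃SepCoPH F 2) (v : Node00.Revision₁₃ F 2 θ h)

/-- β-face invariant under revision (rfl). -/
example : (Node00.datumOfRecord₁₃SepCoPHV F 2 θ h v).βfun = (Node00.datumOfRecord₁₃SepCoPH F 2 θ h).βfun := rfl

/-- β-face is the record β by name (rfl). -/
example : (Node00.datumOfRecord₁₃SepCoPHV F 2 θ h v).βfun = Node00.betaOfRecord₁₃ F 2 θ.toStage13Params := rfl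

/-- B12-face (flow ∕ endpoint carrier) invariant under revision (rfl). -/
example : (Node00.datumOfRecord₁₃SepCoPHV F 2 θ h v).C.toB12 = (Node00.datumOfRecord₁₃SepCoPH F 2 θ h).C.toB12 := rfl

/-- Hence R4's END binder is revision-invariant definitionally. -/
example : EndpointExistence (Node00.datumOfRecord₁₃SepCoPHV F 2 θ h v).C.toB12 ↔
    EndpointExistence (Node00.datumOfRecord₁₃SepCoPH F 2 θ h).C.toB12 := Iff.rfl

/-- The trivial revision returns the record datum (DOOR, rfl). -/
example : Node00.datumOfRecord₁₃SepCoPHV F 2 θ h (Node00.Revision₁₃.refl F 2 θ h) = Node00.datumOfRecord₁₃SepCoPH F 2 θ h := rfl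

end Crit2VersionSlotProbe
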